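import Literature.AlgebraicGeometry.Modules.SerreTwistOneOfFrameSectionsIso
import Literature.AlgebraicGeometry.Modules.RankOneEndomorphismScalar
import Literature.AlgebraicGeometry.Motives.GeneratingSectionsFrameIndependence
import HarnessLib

/-!
# Generating sections defining the SAME morphism to `𝐏ʳ` differ by a global unit (Hartshorne II Thm. 7.1, uniqueness of `(𝓛, s)`)

Layer `Literature/AlgebraicGeometry/Modules`, namespaces `Literature.AlgebraicGeometry.Modules` (§1) and `….Modules.SerreTwist`
(§2–§4).  THEOREMS ONLY (no definition, no named fact, no instance, no notation, no `sorry`).  Cell `hodgecm-mathlib` (D-0151),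
floor-0 programme P1, sub-line F-13 (`stub_PL`), inner target P3 «unit cocycle of a linear rigidification», socket (S0) «two frame
data of the same linear rigidification differ by ONE unit» — this file is its generic half LACK-A («two generating families of
sections with the same morphism differ by one global unit of `X`»); the base-unit form follows by Stein (★
`AbelianSchemeSteinOfNoetherian.baseChange_appTop_bijective`) in the consumer.  Count-neutral capital: HC_CM is proved only modulo
the 7 printed citations until rung 0 closes — nothing here bears on a summit statement.

[Hartshorne1977] II Thm. 7.1: morphisms `φ : X → 𝐏ʳ_A` correspond to invertible sheaves `𝓛` with generating sections
`s₀, …, s_r` UP TO ISOMORPHISM of such data, via `𝓛 ≅ φ^*𝒪(1)`, `s_i ↦ x_i`.  Hence two generating families `s`, `s'` of the SAME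
rank-one module `E` define the same morphism iff `s'_i = v · s_i` for an automorphism `v` of `E`, i.e. (II Ex. 5.1 (b):
`𝓔nd(E) = 𝒪_X`) a global unit `v ∈ Γ(X, 𝒪_X)ˣ`.  In the tree's currency (★ `Motives/GeneratingSectionsOfLineBundle`: coefficients
`coeffAt` in a rank-one frame system `F`, datum `D = ofCocycleSections F.U (ofFrameSystem F h1 s) hcov`, morphism `D.toProj q`;
★ `Modules/SerreTwistMod`: `𝒪_X(1) = twistMod φ 𝒪_X 1`):

* §1 `exists_isUnit_hom_eq_globalScalar_of_iso` — an automorphism `γ` of a rank-one locally free module is multiplication by a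
  global UNIT `v` (★ `RankOneEndomorphismScalar.exists_unique_eq_globalScalar` for `γ.hom` and `γ.inv`, ★ `globalScalar_mul`,
  ★ `eq_of_globalScalar_eq`).
* §2 **`SerreTwist.exists_isUnit_smul_eq_of_toProj_eq`** — if `s` and `s'` (coefficients read in ONE frame system `F`) define the same
  morphism `D.toProj q = D'.toProj q`, then `∃ v, IsUnit v ∧ ∀ i, s' i = v • s i`: compose the two isomorphisms `E ≅ 𝒪_X(1)`,
  `s_i ↦ x_i`, `s'_i ↦ x_i` of ★ `exists_iso_twistMod_one_toProj_app_eq_monomialSection` to an automorphism `s_i ↦ s'_i`, then §1.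
* §3 `SerreTwist.exists_isUnit_smul_eq_of_toProj_eq_of_frameSystem` — the same with `s'` read in ANOTHER frame system `F'`
  (★ `GeneratingSectionsFrameIndependence.ofCocycleSections_ofFrameSystem_eq`).
* §4 `SerreTwist.exists_isUnit_smul_eq_of_homEquiv_pointOfSections_eq` — the `𝐏(J; S)` form (★ `homEquiv_pointOfSections`), the
  shape in which ★ `PolarizedAbelianSchemeWithLevel.IsFrameRigidification` records the morphism.

## References
* [Hartshorne1977] R. Hartshorne, *Algebraic Geometry* (1977), II Thm. 7.1 (a), (b) (p. 150); II Ex. 5.1 (b)–(d) (p. 123).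
* [MumfordFogartyKirwan1994] D. Mumford, J. Fogarty, F. Kirwan, *Geometric Invariant Theory*, 3rd ed. (1994), Ch. 7 §2 Def. 7.5
  (p. 130), Prop. 7.6 (p. 136) — the consumer (two linear rigidifications with the same embedding), not used in the proofs.
-/

noncomputable section

-- `TopCat.Presheaf`/`Scheme.Modules` are not reducible (as in Mathlib's `AlgebraicGeometry/Modules/Sheaf.lean`).
set_option backward.isDefEq.respectTransparency false

universe u

open CategoryTheory AlgebraicGeometry TopologicalSpace Opposite
open Literature.AlgebraicGeometry.Motives Literature.AlgebraicGeometry.Motives.GeneratingSections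
open Literature.AlgebraicGeometry.Morphisms Literature.AlgebraicGeometry.Morphisms.ProjCech

namespace Literature.AlgebraicGeometry.Modules

/-! ## §1 Automorphisms of a rank-one locally free module are global units -/

/-- **An automorphism of a locally free `𝒪_X`-module of rank one is multiplication by a global UNIT**: `γ = v · 𝟙_E` with
`v ∈ Γ(X, 𝒪_X)` invertible — `γ` and `γ⁻¹` are multiplications by global functions `v`, `w` (`𝓔nd(E) = 𝒪_X`,
★ `exists_unique_eq_globalScalar`), and `w · v = 1` because `a ↦ a · 𝟙_E` is injective and multiplicative.
[cite: Hartshorne1977, II Ex. 5.1 (b)–(d) (p. 123)] -/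
theorem exists_isUnit_hom_eq_globalScalar_of_iso {X : Scheme.{u}} {E : X.Modules} (h₁ : HasRank E 1) (γ : E ≅ E) :
    ∃ v : Γ(X, ⊤), IsUnit v ∧ γ.hom = globalScalar E v := by
  obtain ⟨v, hv, -⟩ := exists_unique_eq_globalScalar h₁ γ.hom
  obtain ⟨w, hw, -⟩ := exists_unique_eq_globalScalar h₁ γ.inv
  refine ⟨v, ?_, hv⟩
  have h : globalScalar E (w * v) = globalScalar E (1 : Γ(X, ⊤)) := by
    rw [globalScalar_mul, ← hv, ← hw, γ.hom_inv_id, globalScalar_one]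
  have hwv : w * v = 1 := eq_of_globalScalar_eq Nat.one_pos h₁ h
  rw [mul_comm] at hwv
  exact IsUnit.of_mul_eq_one _ hwv

namespace SerreTwist

/-! ## §2 Same morphism, same frame system: `s' = v · s` -/

section OneFrame

variable {A : Type u} [CommRing A] {r : ℕ} {X : Scheme.{u}} (q : X ⟶ Spec (.of A)) {E : X.Modules}
  (F : FrameSystem E) (h1 : ∀ x, F.rank x = 1) (s s' : Fin (r + 1) → Γ(E, ⊤))
  (hcov : ⨆ i, ⨆ x, X.basicOpen ((CocycleSections.ofFrameSystem F h1 s).coeff i x) = ⊤)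
  (hcov' : ⨆ i, ⨆ x, X.basicOpen ((CocycleSections.ofFrameSystem F h1 s').coeff i x) = ⊤)

/-- **[Hartshorne1977] II Thm. 7.1, UNIQUENESS OF THE DATA `(𝓛, s)`: two generating families of global sections of a rank-one
module that define the SAME morphism `X → 𝐏ʳ_A` differ by a global unit.**  For a rank-one frame system `F` of `E` and families
`s`, `s'` (loci covering) with `D.toProj q = D'.toProj q`, there is `v ∈ Γ(X, 𝒪_X)` invertible with `s'_i = v · s_i` for all `i`:
the isomorphisms `e : E ≅ 𝒪_X(1)` (`s_i ↦ x_i`) and `e' : E ≅ 𝒪_X(1)` (`s'_i ↦ x_i`) of II Thm. 7.1 (a)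
(★ `exists_iso_twistMod_one_toProj_app_eq_monomialSection`) compose to an automorphism `e ≫ e'⁻¹ : s_i ↦ s'_i`, which is a
global unit (§1). [cite: Hartshorne1977, II Thm. 7.1 (a) (p. 150)] [cite: Hartshorne1977, II Ex. 5.1 (b)–(d) (p. 123)] -/
theorem exists_isUnit_smul_eq_of_toProj_eq
    (h : (ofCocycleSections F.U (CocycleSections.ofFrameSystem F h1 s) hcov).toProj q =
      (ofCocycleSections F.U (CocycleSections.ofFrameSystem F h1 s') hcov').toProj q) :
    ∃ v : Γ(X, ⊤), IsUnit v ∧ ∀ i, s' i = v • s i := by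
  set φ : X ⟶ PP A r := (ofCocycleSections F.U (CocycleSections.ofFrameSystem F h1 s) hcov).toProj q with hφ
  set φ' : X ⟶ PP A r := (ofCocycleSections F.U (CocycleSections.ofFrameSystem F h1 s') hcov').toProj q with hφ'
  obtain ⟨e, he⟩ := exists_iso_twistMod_one_toProj_app_eq_monomialSection F h1 s hcov q
  obtain ⟨e', he'⟩ := exists_iso_twistMod_one_toProj_app_eq_monomialSection F h1 s' hcov' q
  -- transport `e'` along `φ' = φ`
  have key : ∀ (ψ : X ⟶ PP A r) (_ : ψ = φ) (e₁ : E ≅ twistMod ψ (unitModule X) 1)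
      (_ : ∀ i, e₁.hom.app ⊤ (s' i) = monomialSection ψ 1 (fun _ : Fin 1 => i)),
      ∃ e₂ : E ≅ twistMod φ (unitModule X) 1, ∀ i, e₂.hom.app ⊤ (s' i) = monomialSection φ 1 (fun _ : Fin 1 => i) := by
    rintro ψ rfl e₁ he₁
    exact ⟨e₁, he₁⟩
  obtain ⟨e'', he''⟩ := key φ' h.symm e' he'
  -- the automorphism `s_i ↦ s'_i`
  have hγ : ∀ i, (e ≪≫ e''.symm).hom.app ⊤ (s i) = s' i := fun i => by
    change (e.hom ≫ e''.inv).app ⊤ (s i) = s' i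
    rw [Scheme.Modules.Hom.comp_app, CategoryTheory.comp_apply, he i, ← he'' i, ← CategoryTheory.comp_apply,
      ← Scheme.Modules.Hom.comp_app, Iso.hom_inv_id, Scheme.Modules.Hom.id_app, CategoryTheory.id_apply]
  obtain ⟨v, hv, hγv⟩ := exists_isUnit_hom_eq_globalScalar_of_iso (F.hasRank 1 h1) (e ≪≫ e''.symm)
  refine ⟨v, hv, fun i => ?_⟩
  rw [← hγ i, hγv, globalScalar_app_apply]
  congr 1
  exact secRes_self v

end OneFrame

/-! ## §3 Same morphism, two frame systems -/

section TwoFrames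

variable {A : Type u} [CommRing A] {r : ℕ} {X : Scheme.{u}} (q : X ⟶ Spec (.of A)) {E : X.Modules}
  (F F' : FrameSystem E) (h1 : ∀ x, F.rank x = 1) (h1' : ∀ x, F'.rank x = 1) (s s' : Fin (r + 1) → Γ(E, ⊤))
  (hcov : ⨆ i, ⨆ x, X.basicOpen ((CocycleSections.ofFrameSystem F h1 s).coeff i x) = ⊤)

/-- The loci `X_{s'_i}` read in the frame system `F'` cover iff they do read in `F` (★ `iSup_basicOpen_coeff_le_of_rescale` at the
change of frame ★ `map_coeffAt_eq_coord_mul_map_coeffAt`). [cite: Hartshorne1977, II Thm. 7.1 (p. 150)] -/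
theorem iSup_basicOpen_coeff_eq_top_of_frameSystem
    (hcov' : ⨆ i, ⨆ x, X.basicOpen ((CocycleSections.ofFrameSystem F' h1' s').coeff i x) = ⊤) :
    ⨆ i, ⨆ x, X.basicOpen ((CocycleSections.ofFrameSystem F h1 s').coeff i x) = ⊤ := by
  have hUF : ⨆ x, F.U x = ⊤ := eq_top_iff.mpr fun x _ => Opens.mem_iSup.mpr ⟨x, F.mem x⟩
  refine top_le_iff.mp (hcov'.symm.le.trans (iSup_mono fun i => ?_))
  exact iSup_basicOpen_coeff_le_of_rescale (CocycleSections.ofFrameSystem F' h1' s') (CocycleSections.ofFrameSystem F h1 s')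
    hUF
    (fun x y => coord (F'.frame x) (homOfLE (inf_le_left : F'.U x ⊓ F.U y ≤ F'.U x))
      (E.presheaf.map (homOfLE (inf_le_right : F'.U x ⊓ F.U y ≤ F.U y)).op
        (basisSection (F.frame y) (F.idx h1 y))) (F'.idx h1' x))
    (fun x y => isUnit_coord_basisSection F' F h1' h1 x y)
    (fun i x y => map_coeffAt_eq_coord_mul_map_coeffAt F' F h1' h1 s' i x y) i

/-- **Two generating families read in TWO frame systems and defining the same morphism differ by a global unit** (§2 after
★ `ofCocycleSections_ofFrameSystem_eq`: the datum of `(E, s')` does not depend on the frame system).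
[cite: Hartshorne1977, II Thm. 7.1 (a) (p. 150)] [cite: Hartshorne1977, II Ex. 5.1 (b)–(d) (p. 123)] -/
theorem exists_isUnit_smul_eq_of_toProj_eq_of_frameSystem
    (hcov' : ⨆ i, ⨆ x, X.basicOpen ((CocycleSections.ofFrameSystem F' h1' s').coeff i x) = ⊤)
    (h : (ofCocycleSections F.U (CocycleSections.ofFrameSystem F h1 s) hcov).toProj q =
      (ofCocycleSections F'.U (CocycleSections.ofFrameSystem F' h1' s') hcov').toProj q) :
    ∃ v : Γ(X, ⊤), IsUnit v ∧ ∀ i, s' i = v • s i := by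
  have hcov'' := iSup_basicOpen_coeff_eq_top_of_frameSystem F F' h1 h1' s' hcov'
  rw [← ofCocycleSections_ofFrameSystem_eq F F' h1 h1' s' hcov'' hcov'] at h
  exact exists_isUnit_smul_eq_of_toProj_eq q F h1 s s' hcov hcov'' h

end TwoFrames

/-! ## §4 The `𝐏(J; S)` form -/

/-- **The `𝐏(J; S)` form** (the shape ★ `PolarizedAbelianSchemeWithLevel.IsFrameRigidification` ends in): two generating families
`s`, `s'` of a rank-one module `E` on `X → S`, read in frame systems `F`, `F'`, whose `S`-points ★ `pointOfSections` of `𝐏(J; S)`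
read back through ★ `homEquiv` coincide, differ by a global unit of `X` (★ `homEquiv_pointOfSections` + §3).
[cite: Hartshorne1977, II Thm. 7.1 (a) (p. 150)] [cite: MumfordFogartyKirwan1994, Ch. 7 §2 Def. 7.5 (p. 130)] -/
theorem exists_isUnit_smul_eq_of_homEquiv_pointOfSections_eq {J : Type u} [Finite J] {X S : Scheme.{u}} (q : X ⟶ S)
    {E : X.Modules} (F F' : FrameSystem E) (h1 : ∀ x, F.rank x = 1) (h1' : ∀ x, F'.rank x = 1)
    (s s' : Fin (Nat.card J + 1) → Γ(E, ⊤))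
    (hcov : ⨆ i, ⨆ x, X.basicOpen ((CocycleSections.ofFrameSystem F h1 s).coeff i x) = ⊤)
    (hcov' : ⨆ i, ⨆ x, X.basicOpen ((CocycleSections.ofFrameSystem F' h1' s').coeff i x) = ⊤)
    (h : Morphisms.projectiveSpace.homEquiv (ι := J) (Over.mk q)
        (Morphisms.projectiveSpace.pointOfSections (Over.mk q)
          (ofCocycleSections F.U (CocycleSections.ofFrameSystem F h1 s) hcov)) =
      Morphisms.projectiveSpace.homEquiv (ι := J) (Over.mk q)
        (Morphisms.projectiveSpace.pointOfSections (Over.mk q)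
          (ofCocycleSections F'.U (CocycleSections.ofFrameSystem F' h1' s') hcov'))) :
    ∃ v : Γ(X, ⊤), IsUnit v ∧ ∀ i, s' i = v • s i := by
  rw [Morphisms.projectiveSpace.homEquiv_pointOfSections, Morphisms.projectiveSpace.homEquiv_pointOfSections] at h
  exact exists_isUnit_smul_eq_of_toProj_eq_of_frameSystem _ F F' h1 h1' s s' hcov hcov' h

end SerreTwist

end Literature.AlgebraicGeometry.Modules

end
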